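import Summits.Ventures.HSemireg.ObstructionLocusBlockDevissageExt
import Summits.Ventures.HSemireg.ObstructionLocusBlockPoint
import Summits.Ventures.HSemireg.ObstructionLocusCrossingCore
import Summits.Ventures.HSemireg.ObstructionLocusCrossingDoubleCokernel
import Summits.Ventures.HSemireg.ObstructionLocusCrossingQuotient

/-!
# Venture HSemireg — (S5) OBSTRUCTION LOCUS away from secant type, XXXV: EXT-NOTE §6.B(c) AT A CROSSING GERM,
# KÜNNETH-FREE — `Ext²_R(I_M, I_M) ≃ₗ[R] Π_{(a,b) ∈ Br(S)} Π_{(c,d) ∈ Br(S′)} R ⧸ (x_a, x_b, x_c, x_d)` for every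
# TWO-BLOCK model (every crossing point of two translates of a (GEN) arrangement), over ANY commutative ring

HONEST FRAMING.  Part of the Lean side of the computation cell `pub-hsemireg` (track «S4-PUSH» (ii), seat
s4-prove-2).  Plain commutative / homological algebra in `R = MvPolynomial (Fin n) K`, every `n`, EVERY commutative
ring `K`, with Mathlib's derived `CategoryTheory.Abelian.Ext`.  Nothing here constructs a variety or a sheaf; nothing
here says that HC / HC_CM / HC_AV holds; no Literature fact is declared or used; no object is certified.

THE STATEMENT (EXT-NOTE §6.B(c), `q = r = 2`).  For a block model `M` with exactly two blocks `S = S_{i₀}` and `S′`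
(ideal `I_M = I_S ∩ I_{S′}`, file XXVII), **`extTwoEquivCrossing`**:
`Ext²_R(I_M, I_M) ≃ₗ[R] Π_{t′ ∈ Br(S′)} Π_{t ∈ Br(S)} R ⧸ ((x_{t.b}, x_{t.a}) + (x_{t′.b}, x_{t′.a}))` — «rank
`4 = 2 · 2` on `B ∩ B′`» for every pair of components `B ⊂` block `S`, `B′ ⊂` block `S′`: the stalk of `𝓔xt²(I_Z, I_Z)`
at a crossing point of two translates, i.e. the `E₂^{p,2}` input of EXT-NOTE §6.D (`extTwoEquivCrossing_ofPoint` states it on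
file XXIV's `Blocks.ofPoint` for a point through which exactly two translates pass; `extTwoEquivCrossing_ofCardEqTwo`
for `Fintype.card ι = 2`).  (`𝓔xt^{≥3} = 0` there is file XXX's
`ext_arrIdeal_subsingleton_of_card_lt`.)

THE PROOF (no Künneth formula, no grading).  `V := I_{S′}` has `pd ≤ 1` (file XXVI), so along the dévissage
`0 → V^{S∖a₀} →Φ V^S → I_M → 0` (files XXVII/XXVIII):
(1) `Ext²(I_M, I_M) = Ext¹(V^{S∖a₀}, I_M) ⧸ Φ^*` (file XXXI's cokernel, `Ext²(V^S, I_M) = 0`);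
(2) `Ext¹(V, I_M) = Ext¹(V, V^S) ⧸ Φ_*` (the covariant cokernel, `Ext²(V, V^{S∖a₀}) = 0`);
(3) on finite powers `Φ^*`, `Φ_*` are the scalar matrices `Φᵀ`, `Φ` (file XXXI), and `Ext¹(V, V) = N′` (file XXVI);
(4) flattening (file XXXIII) gives the double cokernel `Y(N′)`, which commutes with the product
`N′ = Π_{t′} R ⧸ J_{t′}` (file XXXIII), base-changes along `R ↠ R ⧸ J_{t′}` (file XXXIV), and `Y(R) = N_S` is file
XXXII's core; finally `N_S ⧸ J·N_S = Π_t R ⧸ ((x_b, x_a) + J)` (file XXXIV).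
References (dictionary only): EXT-NOTE.md §6.A, §6.B(b)(c), §6.D.
-/

open CategoryTheory CategoryTheory.Abelian MvPolynomial Finset
open scoped BigOperators

universe u

namespace Summit.Ventures.HSemireg.ObstructionLocus.BlockModel

variable {K : Type u} [CommRing K] {n : ℕ}

/-! ## Generic transports -/

section Transport

variable {A : Type u} [CommRing A] {P P' : Type u} [AddCommGroup P] [Module A P] [AddCommGroup P'] [Module A P']
  {T₁ T₂ : Type} [Fintype T₁]

/-- Scalar matrices commute with entrywise linear equivalences: the ranges correspond. -/
theorem map_range_scalarMatrix (c : T₂ → T₁ → A) (e : P ≃ₗ[A] P') :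
    (LinearMap.range (scalarMatrix P c)).map
        ((LinearEquiv.piCongrRight fun _ : T₂ => e) : (T₂ → P) →ₗ[A] (T₂ → P')) =
      LinearMap.range (scalarMatrix P' c) := by
  have key : ∀ w : T₁ → P,
      (LinearEquiv.piCongrRight fun _ : T₂ => e) (scalarMatrix P c w) = scalarMatrix P' c (fun a => e (w a)) := by
    intro w
    funext b
    simp [scalarMatrix_apply, map_sum, map_smul]
  apply le_antisymm
  · rintro _ ⟨_, ⟨w, rfl⟩, rfl⟩
    exact ⟨fun a => e (w a), (key w).symm⟩
  · rintro _ ⟨w', rfl⟩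
    refine ⟨scalarMatrix P c (fun a => e.symm (w' a)), ⟨_, rfl⟩, ?_⟩
    rw [LinearEquiv.coe_coe, key]
    simp

/-- `(P^{T₂} ⧸ range c_P) ≃ₗ (P'^{T₂} ⧸ range c_{P'})` along `e : P ≃ P'`. -/
noncomputable def quotRangeCongr (c : T₂ → T₁ → A) (e : P ≃ₗ[A] P') :
    ((T₂ → P) ⧸ LinearMap.range (scalarMatrix P c)) ≃ₗ[A] ((T₂ → P') ⧸ LinearMap.range (scalarMatrix P' c)) :=
  Submodule.Quotient.equiv _ _ (LinearEquiv.piCongrRight fun _ : T₂ => e) (map_range_scalarMatrix c e)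

/-- Transport of `Ext²(J, J)` along an equality of ideals. -/
noncomputable def extTwoCongrOfEq {J J' : Ideal A} (h : J = J') :
    Ext.{u} (ModuleCat.of A ↥J) (ModuleCat.of A ↥J) 2 ≃ₗ[A] Ext.{u} (ModuleCat.of A ↥J') (ModuleCat.of A ↥J') 2 := by
  subst h; exact LinearEquiv.refl _ _

end Transport

/-! ## The two-block setting -/

section TwoBlocks

variable {ι : Type} [Fintype ι] [DecidableEq ι] (B : Blocks ι n) (i₀ : ι) [Unique {j // j ≠ i₀}]
  {a₀ : Fin n} (ha₀ : a₀ ∈ B.S i₀)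

/-- The other block's ideal `V = I_{M′}`. -/
noncomputable abbrev otherIdeal : Ideal (MvPolynomial (Fin n) K) := arrIdeal K (B.restrict (· ≠ i₀))

omit [Unique {j // j ≠ i₀}] in
/-- The dévissage of `I_M` along the block `S_{i₀}` is short exact. -/
theorem devissage_shortExact_twoBlocks :
    (devissage (B.S i₀) (otherIdeal (K := K) B i₀) ha₀).ShortExact :=
  devissage_shortExact (B.S i₀) _ ha₀ (X_mul_mem_arrIdeal_imp (disjoint_allBlocks_restrict B i₀))
    (blockIdeal_inf_arrIdeal_restrict_le_mul B i₀)

/-- The first map of the dévissage is the scalar matrix `hbMatrix` on `V`-valued vectors. -/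
theorem devissage_f (V : Ideal (MvPolynomial (Fin n) K)) (S : Finset (Fin n)) {a : Fin n} (ha : a ∈ S) :
    (devissage S V ha).f = ModuleCat.ofHom (scalarMatrix ↥V (hbMatrix (K := K) S a)) := by
  show ModuleCat.ofHom (hbMap S a V) = _
  rw [hbMap_eq_scalarMatrix]

omit [Fintype ι] [DecidableEq ι] in
/-- `pd_R V ≤ 1`: `Ext²_R(V, −) = 0`. -/
theorem ext_two_otherIdeal_eq_zero (Y : ModuleCat.{u} (MvPolynomial (Fin n) K))
    (e : Ext.{u} (ModuleCat.of (MvPolynomial (Fin n) K) ↥(otherIdeal (K := K) B i₀)) Y 2) : e = 0 :=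
  e.eq_zero_of_hasProjectiveDimensionLT 2 (le_refl 2)

/-! ### Step 1: `Ext²(I, I) = Ext¹(V^{S∖a₀}, I) ⧸ Φ^*`, and `Φ^*` is `Φᵀ` on `Ext¹(V, I)`-valued vectors -/

/-- The coefficient module `E = Ext¹_R(V, I_M)` of Step 1. -/
noncomputable abbrev EOne : Type u :=
  Ext.{u} (ModuleCat.of (MvPolynomial (Fin n) K) ↥(otherIdeal (K := K) B i₀))
    (ModuleCat.of (MvPolynomial (Fin n) K) ↥(blockIdeal K (B.S i₀) ⊓ otherIdeal (K := K) B i₀)) 1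

omit [Fintype ι] [DecidableEq ι] [Unique {j // j ≠ i₀}] in
/-- Under `extPiEquiv`, the range of `Φ^*` on `Ext¹(V^S, I)` is the range of `Φᵀ` on `E`-valued vectors. -/
theorem map_range_extPrecomp_eq :
    (LinearMap.range (extPrecomp (S := devissage (B.S i₀) (otherIdeal (K := K) B i₀) ha₀)
        (ModuleCat.of (MvPolynomial (Fin n) K) ↥(blockIdeal K (B.S i₀) ⊓ otherIdeal (K := K) B i₀)) 1)).map
      (extPiEquiv ↥(otherIdeal (K := K) B i₀) ↥((B.S i₀).erase a₀)
          (ModuleCat.of (MvPolynomial (Fin n) K) ↥(blockIdeal K (B.S i₀) ⊓ otherIdeal (K := K) B i₀)) 1 :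
        _ →ₗ[MvPolynomial (Fin n) K] (↥((B.S i₀).erase a₀) → EOne (K := K) B i₀)) =
      LinearMap.range (scalarMatrix (EOne (K := K) B i₀) (fun b a => hbMatrix (K := K) (B.S i₀) a₀ a b)) := by
  have key : ∀ ζ, extPiEquiv ↥(otherIdeal (K := K) B i₀) ↥((B.S i₀).erase a₀)
      (ModuleCat.of (MvPolynomial (Fin n) K) ↥(blockIdeal K (B.S i₀) ⊓ otherIdeal (K := K) B i₀)) 1
      (extPrecomp (S := devissage (B.S i₀) (otherIdeal (K := K) B i₀) ha₀) _ 1 ζ) =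
      scalarMatrix (EOne (K := K) B i₀) (fun b a => hbMatrix (K := K) (B.S i₀) a₀ a b)
        (extPiEquiv ↥(otherIdeal (K := K) B i₀) ↥(B.S i₀) _ 1 ζ) := by
    intro ζ
    funext b
    rw [extPrecomp_apply, devissage_f, extPiEquiv_precomp_scalarMatrix, scalarMatrix_apply]
  apply le_antisymm
  · rintro _ ⟨_, ⟨ζ, rfl⟩, rfl⟩
    exact ⟨_, (key ζ).symm⟩
  · rintro _ ⟨w, rfl⟩
    refine ⟨extPrecomp _ 1 ((extPiEquiv ↥(otherIdeal (K := K) B i₀) ↥(B.S i₀) _ 1).symm w), ⟨_, rfl⟩, ?_⟩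
    rw [LinearEquiv.coe_coe, key, LinearEquiv.apply_symm_apply]

/-- **Step 1**: `Ext²_R(I_M, I_M) ≃ₗ[R] E^{S∖a₀} ⧸ range Φᵀ`, `E = Ext¹_R(V, I_M)`. -/
noncomputable def stepOne :
    Ext.{u} (ModuleCat.of (MvPolynomial (Fin n) K) ↥(blockIdeal K (B.S i₀) ⊓ otherIdeal (K := K) B i₀))
        (ModuleCat.of (MvPolynomial (Fin n) K) ↥(blockIdeal K (B.S i₀) ⊓ otherIdeal (K := K) B i₀)) 2
      ≃ₗ[MvPolynomial (Fin n) K]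
        ((↥((B.S i₀).erase a₀) → EOne (K := K) B i₀) ⧸
          LinearMap.range (scalarMatrix (EOne (K := K) B i₀) (fun b a => hbMatrix (K := K) (B.S i₀) a₀ a b))) :=
  (extCokernelEquiv (devissage_shortExact_twoBlocks (K := K) B i₀ ha₀) _ 1 (fun e => by
      rw [← (extPiEquiv ↥(otherIdeal (K := K) B i₀) ↥(B.S i₀) _ 2).symm_apply_apply e]
      have : extPiEquiv ↥(otherIdeal (K := K) B i₀) ↥(B.S i₀) _ 2 e = 0 :=
        funext fun a => ext_two_otherIdeal_eq_zero B i₀ _ _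
      rw [this, map_zero])).symm.trans
    (Submodule.Quotient.equiv _ _ _ (map_range_extPrecomp_eq (K := K) B i₀ ha₀))

/-! ### Step 2: `E = Ext¹(V, V^S) ⧸ Φ_*`, and `Φ_*` is `Φ` on `Ext¹(V, V)`-valued vectors; `Ext¹(V, V) = N′` -/

/-- `E′ = Ext¹_R(V, V)`. -/
noncomputable abbrev EPrime : Type u :=
  Ext.{u} (ModuleCat.of (MvPolynomial (Fin n) K) ↥(otherIdeal (K := K) B i₀))
    (ModuleCat.of (MvPolynomial (Fin n) K) ↥(otherIdeal (K := K) B i₀)) 1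

omit [Fintype ι] [DecidableEq ι] [Unique {j // j ≠ i₀}] in
/-- Under `extCoPiEquiv`, the range of `Φ_*` on `Ext¹(V, V^{S∖a₀})` is the range of `Φ` on `E′`-valued vectors. -/
theorem map_range_extPostcomp_eq :
    (LinearMap.range (extPostcomp (S := devissage (B.S i₀) (otherIdeal (K := K) B i₀) ha₀)
        (ModuleCat.of (MvPolynomial (Fin n) K) ↥(otherIdeal (K := K) B i₀)) 1)).map
      (extCoPiEquiv ↥(otherIdeal (K := K) B i₀) ↥(B.S i₀)
          (ModuleCat.of (MvPolynomial (Fin n) K) ↥(otherIdeal (K := K) B i₀)) 1 :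
        _ →ₗ[MvPolynomial (Fin n) K] (↥(B.S i₀) → EPrime (K := K) B i₀)) =
      LinearMap.range (scalarMatrix (EPrime (K := K) B i₀) (hbMatrix (K := K) (B.S i₀) a₀)) := by
  have key : ∀ ζ, extCoPiEquiv ↥(otherIdeal (K := K) B i₀) ↥(B.S i₀)
      (ModuleCat.of (MvPolynomial (Fin n) K) ↥(otherIdeal (K := K) B i₀)) 1
      (extPostcomp (S := devissage (B.S i₀) (otherIdeal (K := K) B i₀) ha₀) _ 1 ζ) =
      scalarMatrix (EPrime (K := K) B i₀) (hbMatrix (K := K) (B.S i₀) a₀)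
        (extCoPiEquiv ↥(otherIdeal (K := K) B i₀) ↥((B.S i₀).erase a₀) _ 1 ζ) := by
    intro ζ
    funext b
    rw [extPostcomp_apply, devissage_f, extCoPiEquiv_postcomp_scalarMatrix, scalarMatrix_apply]
  apply le_antisymm
  · rintro _ ⟨_, ⟨ζ, rfl⟩, rfl⟩
    exact ⟨_, (key ζ).symm⟩
  · rintro _ ⟨w, rfl⟩
    refine ⟨extPostcomp _ 1 ((extCoPiEquiv ↥(otherIdeal (K := K) B i₀) ↥((B.S i₀).erase a₀) _ 1).symm w),
      ⟨_, rfl⟩, ?_⟩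
    rw [LinearEquiv.coe_coe, key, LinearEquiv.apply_symm_apply]

/-- **Step 2**: `E ≃ₗ[R] N′^S ⧸ range Φ`, `N′ = Π_{t′ ∈ Br(S′)} R ⧸ (x_{t′.b}, x_{t′.a})` the branch functions of
the other block (file XXVI's `extOneEquivOfUnique`). -/
noncomputable def stepTwo :
    EOne (K := K) B i₀ ≃ₗ[MvPolynomial (Fin n) K]
      ((↥(B.S i₀) → BranchFunctions K (B.restrict (· ≠ i₀))) ⧸
        LinearMap.range (scalarMatrix (BranchFunctions K (B.restrict (· ≠ i₀))) (hbMatrix (K := K) (B.S i₀) a₀))) :=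
  ((extCokernelEquiv' (devissage_shortExact_twoBlocks (K := K) B i₀ ha₀)
      (ModuleCat.of (MvPolynomial (Fin n) K) ↥(otherIdeal (K := K) B i₀)) 1 (fun e => by
      rw [← (extCoPiEquiv ↥(otherIdeal (K := K) B i₀) ↥((B.S i₀).erase a₀) _ 2).symm_apply_apply e]
      have : extCoPiEquiv ↥(otherIdeal (K := K) B i₀) ↥((B.S i₀).erase a₀) _ 2 e = 0 :=
        funext fun a => ext_two_otherIdeal_eq_zero B i₀ _ _
      rw [this, map_zero])).symm.trans
    (Submodule.Quotient.equiv _ _ _ (map_range_extPostcomp_eq (K := K) B i₀ ha₀))).trans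
    (quotRangeCongr (hbMatrix (K := K) (B.S i₀) a₀) (extOneEquivOfUnique K (B.restrict (· ≠ i₀))))

/-! ### Steps 3–4: flattening, product, base change, core -/

/-- **Step 3**: `Ext²_R(I_M, I_M) ≃ₗ[R] Y(N′)`, the double cokernel of file XXXIII on `N′`-valued matrices. -/
noncomputable def stepThree :
    Ext.{u} (ModuleCat.of (MvPolynomial (Fin n) K) ↥(blockIdeal K (B.S i₀) ⊓ otherIdeal (K := K) B i₀))
        (ModuleCat.of (MvPolynomial (Fin n) K) ↥(blockIdeal K (B.S i₀) ⊓ otherIdeal (K := K) B i₀)) 2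
      ≃ₗ[MvPolynomial (Fin n) K]
        ((↥((B.S i₀).erase a₀) → ↥(B.S i₀) → BranchFunctions K (B.restrict (· ≠ i₀))) ⧸
          relY (hbMatrix (K := K) (B.S i₀) a₀) (fun b a => hbMatrix (K := K) (B.S i₀) a₀ a b)
            (BranchFunctions K (B.restrict (· ≠ i₀)))) :=
  ((stepOne (K := K) B i₀ ha₀).trans
    (quotRangeCongr (fun b a => hbMatrix (K := K) (B.S i₀) a₀ a b) (stepTwo (K := K) B i₀ ha₀))).trans
    (flattenEquiv _ _).symm

include ha₀ in
/-- **Base change + core, one branch `t′` of the other block**: `Y(R ⧸ J) ≃ₗ[R] Π_{t ∈ Br(S)} R ⧸ ((x_b,x_a) + J)`: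
`Y(R ⧸ J) = R^{(S∖a₀)×S} ⧸ (relY(R) + J·⊤)` (file XXXIV's base change) `= Y(R) ⧸ J·Y(R)`, and `Y(R) = (I_S)^{S∖a₀} ⧸ Φᵀ
= N_S` (flattening + `R^S ⧸ Φ = I_S` + file XXXII's core), `N_S ⧸ J·N_S = Π_t R ⧸ ((x_b, x_a) + J)`. -/
noncomputable def yQuotEquiv (J : Ideal (MvPolynomial (Fin n) K)) :
    ((↥((B.S i₀).erase a₀) → ↥(B.S i₀) → MvPolynomial (Fin n) K ⧸ J) ⧸
        relY (hbMatrix (K := K) (B.S i₀) a₀) (fun b a => hbMatrix (K := K) (B.S i₀) a₀ a b)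
          (MvPolynomial (Fin n) K ⧸ J))
      ≃ₗ[MvPolynomial (Fin n) K]
        ((t : Branch (Blocks.single (B.S i₀) (B.nonempty i₀))) →
          MvPolynomial (Fin n) K ⧸ (Ideal.span {(X t.1.2.2 : MvPolynomial (Fin n) K), X t.1.2.1} ⊔ J)) :=
  -- `R^S ⧸ range Φ ≃ I_S`
  let eU : ((↥(B.S i₀) → MvPolynomial (Fin n) K) ⧸
      LinearMap.range (scalarMatrix (MvPolynomial (Fin n) K) (hbMatrix (K := K) (B.S i₀) a₀))) ≃ₗ[MvPolynomial (Fin n) K]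
        ↥(blockIdeal K (B.S i₀)) :=
    (Submodule.quotEquivOfEq _ _
        (LinearMap.exact_iff.1 (exact_scalarMatrix_hbMatrix_blockGenMap (K := K) ha₀)).symm).trans
      (LinearMap.quotKerEquivOfSurjective _ (blockGenMap_surjective (B.S i₀)))
  -- the core `Y(R) ≃ N_S`
  let d : ((↥((B.S i₀).erase a₀) → ↥(B.S i₀) → MvPolynomial (Fin n) K) ⧸
      relY (hbMatrix (K := K) (B.S i₀) a₀) (fun b a => hbMatrix (K := K) (B.S i₀) a₀ a b)
        (MvPolynomial (Fin n) K)) ≃ₗ[MvPolynomial (Fin n) K]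
          BranchFunctions K (Blocks.single (B.S i₀) (B.nonempty i₀)) :=
    (flattenEquiv _ _).trans
      ((quotRangeCongr (fun b a => hbMatrix (K := K) (B.S i₀) a₀ a b) eU).trans
        (coreEquivBranch K (B.S i₀) (B.nonempty i₀) ha₀))
  (Submodule.quotEquivOfEq _ _ (relY_map_compLeft (hbMatrix (K := K) (B.S i₀) a₀)
      (fun b a => hbMatrix (K := K) (B.S i₀) a₀ a b) J.mkQ (Submodule.mkQ_surjective J)).symm).trans
    ((quotMapEquivOfSurjective (compLeft₂ J.mkQ) (compLeft₂_mkQ_surjective J) _).symm.trans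
      ((Submodule.quotEquivOfEq _ _ (by rw [ker_compLeft₂_mkQ])).trans
        ((quotSupSmulTopEquiv _ J).trans ((quotSmulTopCongr d J).trans (piQuotSmulTopEquiv _ J)))))

/-- **EXT-NOTE §6.B(c) AT A CROSSING GERM (two blocks), over any commutative ring**:
`Ext²_R(I_M, I_M) ≃ₗ[R] Π_{t′ ∈ Br(S′)} Π_{t ∈ Br(S)} R ⧸ ((x_{t.b}, x_{t.a}) + (x_{t′.b}, x_{t′.a}))` for the block
model `M` with the two blocks `S = S_{i₀}` and `S′` — «`𝓔xt²(I_Z, I_Z)` has rank `4 = 2·2` on `B ∩ B′` for every pair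
of components `B ⊂ W + t`, `B′ ⊂ W + t′` through the point, and nothing else». -/
noncomputable def extTwoEquivCrossing :
    Ext.{u} (ModuleCat.of (MvPolynomial (Fin n) K) ↥(arrIdeal K B))
        (ModuleCat.of (MvPolynomial (Fin n) K) ↥(arrIdeal K B)) 2
      ≃ₗ[MvPolynomial (Fin n) K]
        ((t' : Branch (B.restrict (· ≠ i₀))) → (t : Branch (Blocks.single (B.S i₀) (B.nonempty i₀))) →
          MvPolynomial (Fin n) K ⧸
            (Ideal.span {(X t.1.2.2 : MvPolynomial (Fin n) K), X t.1.2.1} ⊔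
              Ideal.span {(X t'.1.2.2 : MvPolynomial (Fin n) K), X t'.1.2.1})) :=
  ((extTwoCongrOfEq (arrIdeal_eq_blockIdeal_inf_restrict (K := K) B i₀)).trans
    (stepThree (K := K) B i₀ ha₀)).trans
    ((quotRelYPiEquiv _ _ _).trans
      (LinearEquiv.piCongrRight fun t' =>
        yQuotEquiv (K := K) B i₀ ha₀ (Ideal.span {(X t'.1.2.2 : MvPolynomial (Fin n) K), X t'.1.2.1})))

/-! ### At a point of a (GEN) arrangement through which exactly two translates pass -/

/-- With exactly two indices, the complement of one index is a singleton. -/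
@[reducible] noncomputable def uniqueNeOfCardEqTwo {ι : Type} [Fintype ι] [DecidableEq ι] (h : Fintype.card ι = 2) (i₀ : ι) :
    Unique {j // j ≠ i₀} :=
  (Fintype.card_eq_one_iff_nonempty_unique.1 (by
    have h1 := Fintype.card_subtype_compl (fun j : ι => j = i₀)
    rw [Fintype.card_subtype_eq, h] at h1
    exact h1)).some

/-- **EXT-NOTE §6.B(c) at a point `q` of a (GEN) arrangement `Z_T` lying on EXACTLY TWO translates** `W + t₀`, `W + t₁`
(file XXIV's block structure `Blocks.ofPoint q T`, blocks = the coincidence sets `S_t(q)`): the `Ext²` of the local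
ideal with itself is `Π_{t′ ∈ Br(S_{t₁}(q))} Π_{t ∈ Br(S_{t₀}(q))} R ⧸ ((x_{t.b}, x_{t.a}) + (x_{t′.b}, x_{t′.a}))` — rank `4` on
each `B ∩ B′`, `B ⊂ W + t₀`, `B′ ⊂ W + t₁` through `q` (the étale-local identification itself stays prose). -/
noncomputable def extTwoEquivCrossing_ofPoint {G : Type} [DecidableEq G] (q : Fin n → G) (T : Finset (Fin n → G))
    (hGEN : ∀ t ∈ T, ∀ t' ∈ T, t ≠ t' → ∀ k, t k ≠ t' k) (h2 : (through q T).card = 2) (t₀ : ↥(through q T))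
    {a₀ : Fin n} (ha₀ : a₀ ∈ (Blocks.ofPoint q T hGEN).S t₀) :
    Ext.{u} (ModuleCat.of (MvPolynomial (Fin n) K) ↥(arrIdeal K (Blocks.ofPoint q T hGEN)))
        (ModuleCat.of (MvPolynomial (Fin n) K) ↥(arrIdeal K (Blocks.ofPoint q T hGEN))) 2
      ≃ₗ[MvPolynomial (Fin n) K]
        ((t' : Branch ((Blocks.ofPoint q T hGEN).restrict (· ≠ t₀))) →
          (t : Branch (Blocks.single ((Blocks.ofPoint q T hGEN).S t₀) ((Blocks.ofPoint q T hGEN).nonempty t₀))) →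
            MvPolynomial (Fin n) K ⧸
              (Ideal.span {(X t.1.2.2 : MvPolynomial (Fin n) K), X t.1.2.1} ⊔
                Ideal.span {(X t'.1.2.2 : MvPolynomial (Fin n) K), X t'.1.2.1})) :=
  haveI := uniqueNeOfCardEqTwo (by rw [Fintype.card_coe]; exact h2) t₀
  extTwoEquivCrossing (K := K) (Blocks.ofPoint q T hGEN) t₀ ha₀

end TwoBlocks

/-- The same statement for a block structure with `Fintype.card ι = 2` (no `Unique` instance to supply). -/
noncomputable def extTwoEquivCrossing_ofCardEqTwo {ι : Type} [Fintype ι] [DecidableEq ι] (B : Blocks ι n)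
    (h2 : Fintype.card ι = 2) (i₀ : ι) {a₀ : Fin n} (ha₀ : a₀ ∈ B.S i₀) :
    Ext.{u} (ModuleCat.of (MvPolynomial (Fin n) K) ↥(arrIdeal K B))
        (ModuleCat.of (MvPolynomial (Fin n) K) ↥(arrIdeal K B)) 2
      ≃ₗ[MvPolynomial (Fin n) K]
        ((t' : Branch (B.restrict (· ≠ i₀))) → (t : Branch (Blocks.single (B.S i₀) (B.nonempty i₀))) →
          MvPolynomial (Fin n) K ⧸
            (Ideal.span {(X t.1.2.2 : MvPolynomial (Fin n) K), X t.1.2.1} ⊔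
              Ideal.span {(X t'.1.2.2 : MvPolynomial (Fin n) K), X t'.1.2.1})) :=
  haveI := uniqueNeOfCardEqTwo h2 i₀
  extTwoEquivCrossing (K := K) B i₀ ha₀

end Summit.Ventures.HSemireg.ObstructionLocus.BlockModel
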